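import Literature.Geometry.Lorentzian.AFEndTransplant
import Literature.Geometry.Lorentzian.AFEndRestrict
import Literature.Geometry.Lorentzian.DilationDecay
import HarnessLib

/-!
# Chart components and decay of rescaled, transplanted data along the transplanted end

Sequel to `AFEndTransplant.lean` (topic `Geometry/Lorentzian`; everything PROVED, no definitions).
Let `T : TransplantData e f λ ρ₀ ρ₁` (an end `e` of the `3`-manifold `X`, an end `f` of `ℝ³`, a
scale `λ > 0`), `Ψ = e.transplantMap λ = λ⁻¹ • coord`, and let `C` be an initial data set on `ℝ³`.
Suppose `S` is an initial data set on `X` whose sections on the open set of the transplanted end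
are the **rescaled pullbacks** of those of `C` along `Ψ`:

  `h_S = λ² Ψ^* h_C`,  `k_S = λ Ψ^* k_C`   on `(transplant T).U`

(the data of the body `C`, dilated by `λ`: `(h, k) ↦ (λ² Δ^*h, λ Δ^*k)`, `Δ y = y/λ`, transported
into `X` by the chart of `e`). Then, beyond radius `λ ρ₁`,

* `hCoeff_transplant` — `hCoeff (transplant T) S ζ = hCoeff f C (λ⁻¹ ζ)`: the chart components of
  `S` along the transplanted end are those of `C` along `f`, read at `λ⁻¹ ζ` (the factors `λ²`
  and `λ⁻¹ · λ⁻¹` from the chain rule cancel);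
* `kCoeff_transplant` — `kCoeff (transplant T) S ζ = λ⁻¹ • kCoeff f C (λ⁻¹ ζ)`.

Consequently the decay of `C` along `f` transfers to `S` along the transplanted end with the mass
parameter multiplied by `λ` (`IsStronglyAsymptoticallyFlatWith.transplant`: every class
`(M, β, γ, nh, nk)` ↦ `(λ M, β, γ, nh, nk)`, by the dilation bookkeeping of `DilationDecay.lean`). This is the structure-at-infinity half of "a dilated
asymptotically flat body is asymptotically flat with dilated mass" (ADM mass scales like a length;
Bartnik 1986, §1 and (4.2)). The vacuum constraints of such `S` are the business of
`InitialDataHomothety.lean` / `InitialDataLocality.lean`.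

## References

* R. Bartnik, *The mass of an asymptotically flat manifold*, CPAM 39 (1986), §1, §4. [Bartnik1986]
* M. Dafermos, I. Rodnianski, *Lectures on black holes and linear waves* (2013), App. B.2.3.
  [DafermosRodnianski2013]
-/

noncomputable section

open Bundle Set Filter TopologicalSpace Metric Bornology Asymptotics
open scoped Manifold ContDiff Topology

namespace Literature.Geometry.Lorentzian


namespace AFEnd

variable {X : Type} [TopologicalSpace X] [ChartedSpace E3 X] [IsManifold (𝓡 3) ∞ X]
  {e : AFEnd X} {f : AFEnd E3} {lam ρ₀ ρ₁ : ℝ} (T : TransplantData e f lam ρ₀ ρ₁)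
  (C : InitialDataSet (𝓡 3) E3) (S : InitialDataSet (𝓡 3) X)

/-! ### Chain rule through the transplanted inverse chart -/

omit [IsManifold (𝓡 3) ∞ X] in
include T in
/-- The inverse chart of the transplanted end followed by the transplant map is the rescaled
inverse chart of `f`: `Ψ ((transplant T).dataChartExt ζ) = f.dataChartExt (λ⁻¹ ζ)` for
`‖ζ‖ > λ ρ₁`. [cite: Bartnik1986, §1] -/
theorem transplantMap_transplant_dataChartExt {ζ : E3} (hζ : lam * ρ₁ < ‖ζ‖) :
    e.transplantMap lam ((transplant T).dataChartExt ζ) = f.dataChartExt (lam⁻¹ • ζ) := by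
  rw [transplant_dataChartExt T hζ]
  exact (transplantInv_mem T hζ).2

omit [IsManifold (𝓡 3) ∞ X] in
include T in
/-- Near `ζ` (`‖ζ‖ > λ ρ₁`), `Ψ ∘ (transplant T).dataChartExt` is `z ↦ f.dataChartExt (λ⁻¹ z)`.
[cite: Bartnik1986, §1] -/
theorem transplantMap_comp_dataChartExt_eventuallyEq {ζ : E3} (hζ : lam * ρ₁ < ‖ζ‖) :
    (e.transplantMap lam ∘ (transplant T).dataChartExt) =ᶠ[𝓝 ζ]
      fun z : E3 ↦ f.dataChartExt (lam⁻¹ • z) := by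
  filter_upwards [(isOpen_lt continuous_const continuous_norm).mem_nhds hζ] with z hz
  exact transplantMap_transplant_dataChartExt T hz

omit [IsManifold (𝓡 3) ∞ X] in
include T in
/-- **Chain rule**: `dΨ ∘ d((transplant T).dataChartExt)_ζ = d(f.dataChartExt)_{λ⁻¹ζ} ∘ (λ⁻¹ •)`.
[cite: Bartnik1986, §1] -/
theorem mfderiv_transplantMap_comp_dataChartExt {ζ : E3} (hζ : lam * ρ₁ < ‖ζ‖) (v : E3) :
    mfderiv (𝓡 3) 𝓘(ℝ, E3) (e.transplantMap lam) ((transplant T).dataChartExt ζ)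
        (mfderiv 𝓘(ℝ, E3) (𝓡 3) (transplant T).dataChartExt ζ v) =
      lam⁻¹ • mfderiv 𝓘(ℝ, E3) (𝓡 3) f.dataChartExt (lam⁻¹ • ζ) v := by
  have hx : (transplant T).dataChartExt ζ ∈ e.U := by
    rw [transplant_dataChartExt T hζ]
    exact ((mem_transplantOpens).1 (transplantInv_mem T hζ).1).1
  have hΨ : MDifferentiableAt (𝓡 3) 𝓘(ℝ, E3) (e.transplantMap lam) ((transplant T).dataChartExt ζ) :=
    (e.contMDiffAt_transplantMap lam hx).mdifferentiableAt (by simp)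
  have hdc : MDifferentiableAt 𝓘(ℝ, E3) (𝓡 3) (transplant T).dataChartExt ζ :=
    ((transplant T).contMDiffAt_dataChartExt hζ).mdifferentiableAt (by simp)
  have hcomp := mfderiv_comp ζ hΨ hdc
  have h1 : mfderiv 𝓘(ℝ, E3) 𝓘(ℝ, E3) (e.transplantMap lam ∘ (transplant T).dataChartExt) ζ =
      mfderiv 𝓘(ℝ, E3) 𝓘(ℝ, E3) (fun z : E3 ↦ f.dataChartExt (lam⁻¹ • z)) ζ :=
    (transplantMap_comp_dataChartExt_eventuallyEq T hζ).mfderiv_eq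
  -- the right-hand side: chain rule for `f.dataChartExt ∘ (λ⁻¹ •)`
  have h2R : f.R < ‖lam⁻¹ • ζ‖ := T.R_lt_norm_inv_smul hζ
  have hfd : MDifferentiableAt 𝓘(ℝ, E3) (𝓡 3) f.dataChartExt (lam⁻¹ • ζ) :=
    (f.contMDiffAt_dataChartExt h2R).mdifferentiableAt (by simp)
  have hsc : MDifferentiableAt 𝓘(ℝ, E3) 𝓘(ℝ, E3) (fun z : E3 ↦ lam⁻¹ • z) ζ :=
    (mdifferentiableAt_id).const_smul lam⁻¹
  have hcomp2 : mfderiv 𝓘(ℝ, E3) (𝓡 3) (f.dataChartExt ∘ fun z : E3 ↦ lam⁻¹ • z) ζ =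
      (mfderiv 𝓘(ℝ, E3) (𝓡 3) f.dataChartExt (lam⁻¹ • ζ)).comp
        (mfderiv 𝓘(ℝ, E3) 𝓘(ℝ, E3) (fun z : E3 ↦ lam⁻¹ • z) ζ) :=
    mfderiv_comp ζ hfd hsc
  have hlin : mfderiv 𝓘(ℝ, E3) 𝓘(ℝ, E3) (fun z : E3 ↦ lam⁻¹ • z) ζ v = lam⁻¹ • v := by
    have h := const_smul_mfderiv (mdifferentiableAt_id (I := 𝓘(ℝ, E3)) (x := ζ)) lam⁻¹
    have h' : (fun z : E3 ↦ lam⁻¹ • z) = lam⁻¹ • (id : E3 → E3) := rfl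
    rw [h', h, mfderiv_id]
    rfl
  have eL : mfderiv (𝓡 3) 𝓘(ℝ, E3) (e.transplantMap lam) ((transplant T).dataChartExt ζ)
      (mfderiv 𝓘(ℝ, E3) (𝓡 3) (transplant T).dataChartExt ζ v) =
      mfderiv 𝓘(ℝ, E3) 𝓘(ℝ, E3) (e.transplantMap lam ∘ (transplant T).dataChartExt) ζ v := by
    rw [hcomp]
    rfl
  rw [eL, h1, show (fun z : E3 ↦ f.dataChartExt (lam⁻¹ • z)) = f.dataChartExt ∘ fun z : E3 ↦ lam⁻¹ • z
    from rfl, hcomp2]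
  exact (congrArg (mfderiv 𝓘(ℝ, E3) (𝓡 3) f.dataChartExt (lam⁻¹ • ζ)) hlin).trans
    ((mfderiv 𝓘(ℝ, E3) (𝓡 3) f.dataChartExt (lam⁻¹ • ζ)).map_smul lam⁻¹ v)

/-! ### The chart components of transplanted data -/

include T in
/-- **The chart components of the metric of transplanted data**: if `h_S = λ² Ψ^* h_C` on the
transplanted region then `hCoeff (transplant T) S ζ = hCoeff f C (λ⁻¹ ζ)` for `‖ζ‖ > λ ρ₁`.
[cite: Bartnik1986, §1] -/
theorem hCoeff_transplant
    (hS : ∀ x ∈ (transplant T).U, S.h.inner x =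
      lam ^ 2 • pullbackBilin (I := 𝓘(ℝ, E3)) (I' := 𝓡 3) (e.transplantMap lam)
        (show Π y : E3, TangentSpace 𝓘(ℝ, E3) y →L[ℝ] TangentSpace 𝓘(ℝ, E3) y →L[ℝ] ℝ from C.h.inner) x)
    {ζ : E3} (hζ : lam * ρ₁ < ‖ζ‖) :
    hCoeff (transplant T) S ζ = hCoeff f C (lam⁻¹ • ζ) := by
  have hζ' : (transplant T).R < ‖ζ‖ := hζ
  have h2R : f.R < ‖lam⁻¹ • ζ‖ := T.R_lt_norm_inv_smul hζ
  have hxU : (transplant T).dataChartExt ζ ∈ (transplant T).U := by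
    rw [transplant_dataChartExt T hζ]
    exact (transplantInv_mem T hζ).1
  ext v w
  rw [(transplant T).hCoeff_apply_eq_dataChartExt S hζ', f.hCoeff_apply_eq_dataChartExt C h2R, hS _ hxU]
  rw [smul_apply, smul_apply, pullbackBilin_apply,
    mfderiv_transplantMap_comp_dataChartExt T hζ, mfderiv_transplantMap_comp_dataChartExt T hζ,
    transplantMap_transplant_dataChartExt T hζ]
  simp only [map_smul, smul_apply, smul_eq_mul]
  have hl : lam ≠ 0 := T.lam_ne
  field_simp

include T in
/-- **The chart components of `k` of transplanted data**: if `k_S = λ Ψ^* k_C` on the transplanted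
region then `kCoeff (transplant T) S ζ = λ⁻¹ • kCoeff f C (λ⁻¹ ζ)` for `‖ζ‖ > λ ρ₁`.
[cite: Bartnik1986, §1] -/
theorem kCoeff_transplant
    (hS : ∀ x ∈ (transplant T).U, S.k x =
      lam • pullbackBilin (I := 𝓘(ℝ, E3)) (I' := 𝓡 3) (e.transplantMap lam)
        (show Π y : E3, TangentSpace 𝓘(ℝ, E3) y →L[ℝ] TangentSpace 𝓘(ℝ, E3) y →L[ℝ] ℝ from C.k) x)
    {ζ : E3} (hζ : lam * ρ₁ < ‖ζ‖) :
    kCoeff (transplant T) S ζ = lam⁻¹ • kCoeff f C (lam⁻¹ • ζ) := by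
  have hζ' : (transplant T).R < ‖ζ‖ := hζ
  have h2R : f.R < ‖lam⁻¹ • ζ‖ := T.R_lt_norm_inv_smul hζ
  have hxU : (transplant T).dataChartExt ζ ∈ (transplant T).U := by
    rw [transplant_dataChartExt T hζ]
    exact (transplantInv_mem T hζ).1
  ext v w
  rw [smul_apply, smul_apply, (transplant T).kCoeff_apply_eq_dataChartExt S hζ',
    f.kCoeff_apply_eq_dataChartExt C h2R, hS _ hxU]
  rw [smul_apply, smul_apply, pullbackBilin_apply,
    mfderiv_transplantMap_comp_dataChartExt T hζ, mfderiv_transplantMap_comp_dataChartExt T hζ,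
    transplantMap_transplant_dataChartExt T hζ]
  simp only [map_smul, smul_apply, smul_eq_mul]
  have hl : lam ≠ 0 := T.lam_ne
  field_simp



/-! ### Decay of transplanted data along the transplanted end -/

include T in
/-- **Strong asymptotic flatness transfers to rescaled transplanted data, with mass `λ M`.** If
`h_S = λ² Ψ^* h_C` and `k_S = λ Ψ^* k_C` on the transplanted region and `C` is of class
`(M, β, γ, nh, nk)` along `f`, then `S` is of class `(λ M, β, γ, nh, nk)` along `transplant T`
(`hCoeff_transplant`, `kCoeff_transplant` and the dilation bookkeeping
`IsStronglyAsymptoticallyFlatWith.of_coeff_dilation` of `DilationDecay.lean`). In particular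
Dafermos–Rodnianski decay with mass `M` becomes Dafermos–Rodnianski decay with mass `λ M`.
Bartnik 1986, §1, §4 (mass scales like a length). [cite: DafermosRodnianski2013, App. B.2.3] -/
theorem IsStronglyAsymptoticallyFlatWith.transplant
    (hSh : ∀ x ∈ (transplant T).U, S.h.inner x =
      lam ^ 2 • pullbackBilin (I := 𝓘(ℝ, E3)) (I' := 𝓡 3) (e.transplantMap lam)
        (show Π y : E3, TangentSpace 𝓘(ℝ, E3) y →L[ℝ] TangentSpace 𝓘(ℝ, E3) y →L[ℝ] ℝ from C.h.inner) x)
    (hSk : ∀ x ∈ (transplant T).U, S.k x =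
      lam • pullbackBilin (I := 𝓘(ℝ, E3)) (I' := 𝓡 3) (e.transplantMap lam)
        (show Π y : E3, TangentSpace 𝓘(ℝ, E3) y →L[ℝ] TangentSpace 𝓘(ℝ, E3) y →L[ℝ] ℝ from C.k) x)
    {M β γ : ℝ} {nh nk : ℕ} (hC : f.IsStronglyAsymptoticallyFlatWith C M β γ nh nk) :
    (transplant T).IsStronglyAsymptoticallyFlatWith S (lam * M) β γ nh nk :=
  IsStronglyAsymptoticallyFlatWith.of_coeff_dilation T.lam_pos
    (fun _ hζ ↦ hCoeff_transplant T C S hSh hζ) (fun _ hζ ↦ kCoeff_transplant T C S hSk hζ) hC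

include T in
/-- Dafermos–Rodnianski decay transfers to rescaled transplanted data with mass `λ M`.
[cite: DafermosRodnianski2013, App. B.2.3] -/
theorem IsStronglyAsymptoticallyFlatDR.transplant
    (hSh : ∀ x ∈ (transplant T).U, S.h.inner x =
      lam ^ 2 • pullbackBilin (I := 𝓘(ℝ, E3)) (I' := 𝓡 3) (e.transplantMap lam)
        (show Π y : E3, TangentSpace 𝓘(ℝ, E3) y →L[ℝ] TangentSpace 𝓘(ℝ, E3) y →L[ℝ] ℝ from C.h.inner) x)
    (hSk : ∀ x ∈ (transplant T).U, S.k x =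
      lam • pullbackBilin (I := 𝓘(ℝ, E3)) (I' := 𝓡 3) (e.transplantMap lam)
        (show Π y : E3, TangentSpace 𝓘(ℝ, E3) y →L[ℝ] TangentSpace 𝓘(ℝ, E3) y →L[ℝ] ℝ from C.k) x)
    {M : ℝ} (hC : f.IsStronglyAsymptoticallyFlatDR C M) :
    (transplant T).IsStronglyAsymptoticallyFlatDR S (lam * M) :=
  IsStronglyAsymptoticallyFlatWith.transplant T C S hSh hSk hC

end AFEnd

end Literature.Geometry.Lorentzian

end
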